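import Literature.MathematicalPhysics.QuantumFieldTheory.Balaban1983to89.Node00.Record12CarriersB12Package
import Literature.MathematicalPhysics.QuantumFieldTheory.Balaban1983to89.B12Eq44Analytic

/-!
# NODE N09 ([Balaban1987RG1] Lemma 4 (3.53) p. 280), FLAG №7 LOCATED RIDER 3, PART 1 — A BY-REFERENCE PACKAGE `JInputs` WITH THE ZERO LETTER `𝐊 = 0` AT `τ = 1` HAS A
# SECOND-ORDER FLAT DATUM: `‖∂U_{k+1}(□₀, M˙(Φ₀))(p) − 1‖ ≤ δ₀ = e^{c_w}·ξ²·(2B₃y² + 8x′²e^{4ξx′})` ON `X` (the package's own (3.37), (3.39), (3.45)×2 and the elementary inequality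
# behind (3.43)); at NODE 00's objects: EVERY zero-letter `B12Package Rz cB λ` returns `δ₀(λ)`-flat data

T. Bałaban, *Renormalization group approach to lattice gauge field theories. I*, Commun. Math. Phys. **109** (1987) 249–301 [Balaban1987RG1] (= [I]), §3 pp. 275–280;
[15] = [Balaban1985BackgroundPropagators] for the lattice calculus (`B9Eq39Adjoint ∕ B9Eq369Product`).  TRACK A (YM-PLAN §2b), WIDTH SEAT `pub-ymgap-dag-n09-w5`
(HUMAN RULING D-0154 ∕ director-ym R399 (3a)), generation g2; LOCATED RIDER to FLAG №7 of record (director-ym №209 «conjunct-1 JUNK-INHABITED at the unit recipe»; chair tags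
«repair = proviso text»), third in this seat's lineage after p607123 `…N09B12ProvisosJunkUnderRzLaws` and p608883 `…N09B12ProvisosJunkInClass`.  Key of record it serves: K1⁷
`StabilityBAtRecordR13SepCoPH` = stmt-QuantumFields-20542 (`--supports`, helper; count-neutral).  PART 2 (`…N09B12FailingLemmaUnderOrbitTie`) draws the FLAG №7 consequences:
№209's «failing lemma» under (orbit-tie ∧ first-order non-flatness of the pinned `bgI`), and the idleness of the tie alone at totally-flat recipes.

WHY.  p607123 ∕ p608883 locate FLAG №7's junk in two UNTIED data of the by-reference package (the residual letter maps `λ.K ∕ λ.A₂`; p07's `JInputs.Φ₀ ∕ 𝐇`).  This part makes the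
located word QUANTITATIVE.  In p07's `JInputs` (one value of the variables of Lemma 4) the identity field `h339` ((3.39)+(3.37): `∂(exp iξ𝐇)(p) = ∂((U_{k+1}(□₀, M˙(Φ₀)))^{(v ū₁
v_j u_j)⁻¹})(p)` on `X`) ties the [15]-function `𝐇` to the PINNED background (`F′.bg.Un (k+1)` = `Rz.bgI` at `□̃⁵`) of the package's upper-space datum `Φ₀`; at `τ = 1` the ZERO letter
`𝐊 = 0` makes the (3.45) fields read `|ℓ| < B₃y²` (`h45τ`) and `|ξ⁻¹∂𝐇 − ℓ| < B₃y²` (`h45`), so the plaquette combination `∂𝐇` is SECOND ORDER, `|∂𝐇(p)| ≤ 2ξB₃y²`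
(`y = B₃O(1)Mα₀L^{j−1}η`); with (3.37) `|𝐇| < x′ = B₃²O(1)Mα₀L^{j−1}η` (`hH`) the elementary inequality behind (3.43) in CURL form at the unit background
(`B9Eq369Product.norm_plaqU_prodCfg_sub_one_le` BY NAME) gives `|∂(exp iξ𝐇)(p) − 1| ≤ ξ|∂𝐇(p)| + ½(4x′)²ξ²e^{4ξx′}`, and undoing the gauge (`plaq_gaugeU`; the four costs
`hv ∕ hubar1 ∕ hvj ∕ huj`, (3.26) ∕ (3.27) ∕ (3.37)) yields `|∂U_{k+1}(□₀, M˙(Φ₀))(p) − 1| ≤ δ₀` on `X` — SECOND ORDER in `α₀` (restrictions: `(4B₃²O(1)M)²α₀ ≤ β`), against the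
FIRST-ORDER window `(1+2β)α₀ξ′²` that (1.16) allows an element of `U′ᶜ_{k+1}(□₀, (1+2β)α₀, (1+2β)α₁, α₀)`.  The letter `𝐀` ∕ `𝐀₂` plays no rôle.

WHAT IS PROVED (kernel bookkeeping; theorems only, def-free, sorry-free, standard axioms; nothing of NODE 00 ∕ p07 ∕ pub-balaban ∕ lit re-declared).
* §1 (any complete normed `ℂ`-algebra) `norm_plaq_expI_sub_one_le` — `‖∂(e^{iξ𝐇})(p) − 1‖ ≤ ξ‖∂𝐇(p)‖ + ½(4h₀)²ξ²e^{ξ·4h₀}` for `‖𝐇‖ ≤ h₀` (`norm_plaqU_prodCfg_sub_one_le` at `U = 1`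
  through the `rfl` dictionary `plaq_eq_plaqU ∕ dirForm_sub310 ∕ sub310_one_eq`); `norm_plaq_sub_one_le_conj` (gauge conjugation); `norm_mul_norm_inv_prod4_le` (four costs multiply).
* §2 (any value model ∕ frames, `𝔸 : Type`) ★ `norm_plaq_bg_sub_one_le_of_jInputs`: `J : JInputs … τ n 𝐊 𝐀`, `τ = 1`, `𝐊 = 0`, `0 < ξ` ⇒ `‖∂(F′.bg.Un cs′.j J.Φ₀.U)(p) − 1‖ ≤ δ₀` on `F.X.plaqs`.
* §3 (NODE 00's objects) ★★ `norm_plaq_bg_repr_sub_one_le_of_zero_letters`: for ANY `pkg : B12Package Rz cB λ` with `λ.K = 0`, `0 ∈ (3.31)`, `0 < α₃`, and any admissible input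
  `Φ`, the datum `(pkg.inputs Φ 0 1 0 …).Φ₀` has a `δ₀(λ)`-flat `(k+1)`-background on `X` (`δ₀(λ)` = §2's constant at `λ.consts`, `ξ = L⁻ʲ`, `η = L⁻ᵏ`).

HONEST FRAMING: LOCATED, count-neutral kernel bookkeeping on NODE 00's ∕ p07's ∕ pub-balaban's ∕ lit's objects read BY NAME; `δ₀` is OUR explicit constant (no optimisation); the zero
letters are a witness for the BINDERS, NOT print's letters — NOT Lemma 4 for `U_j(□₀, ·)`; NO estimate of Bałaban's is proved or denied; N09 NOT discharged; FLAG №7 neither closed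
nor widened; K0⁷ ∕ K1⁷ NOT closed; counts unmoved (typed 28∕28 · discharged 5∕27); no summit statement is proved by this seat; one finite four-torus programme at fixed `ε = L^{−K}` per
run — conditional finite-𝕋⁴ bookkeeping; R4 closes rung `BalabanLadder.UV` only; NOT ℝ⁴, NOT infinite volume, NOT OS, NOT a mass gap, NOT Clay.
-/

noncomputable section

namespace Summit.QuantumFields.YangMills.BalabanUVNodes.N09B12ZeroLetterFlatness

open Literature.MathematicalPhysics.QuantumFieldTheory.Balaban1983to89
open Literature.MathematicalPhysics.QuantumFieldTheory.Balaban1983to89.Node00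
open B12RegularSpaces111 (Frame Region StepConsts Model space Satisfies act expI grad plaq gaugeU)
open B12RegularSpaces111Gauge (plaq_gaugeU)
open B12Eq18Current (dirForm dirForm_apply plaq_eq_plaqU torusT_apply)
open B9TorusCalculus (torusT)
open B9Eq39Adjoint (plaqU curl covD R R_one prodCfg)
open B9Eq369Product (letterSize letterSize_nonneg norm_plaqU_prodCfg_sub_one_le norm_eta_inv_smul_le_iff)
open B12Eq311CurrentExpansion (sub310 dirForm_sub310)
open B12Eq44Analytic (sub310_one_eq)
open B12RegularSpaces111SpecialUnitary (suModel)
open B12Lemma4Models (slProj)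
open B12Lemma4ConcreteFrame (JInputs)
open scoped Matrix.Norms.L2Operator

/-! ## §1. Elementary: the plaquette of `exp iξ𝐇` (curl form of (3.43)), gauge conjugation, the product of four gauge costs -/

section Elementary

variable {P : Params} {i : ℕ} {𝔸 : Type*} [NormedRing 𝔸] [NormedAlgebra ℂ 𝔸] [CompleteSpace 𝔸]

/-- **The elementary inequality behind (3.43), CURL FORM, at the unit background**: for a bond function `𝐇` with `‖𝐇(b)‖ ≤ h₀`,
`‖∂(exp iξ𝐇)(p) − 1‖ ≤ ξ·‖𝐇(b₁) + 𝐇(b₂) − 𝐇(b₃) − 𝐇(b₄)‖ + ½(4h₀)²ξ²e^{ξ·4h₀}` (`b₁…b₄` the bonds of `p`) — `B9Eq369Product.norm_plaqU_prodCfg_sub_one_le` at `U = 1`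
read through the `rfl` dictionary of `B12Eq18Current` ∕ `B12Eq311CurrentExpansion`. [cite: Balaban1987RG1, (3.43) p.278; Balaban1985BackgroundPropagators, p.404 below (3.69)] -/
theorem norm_plaq_expI_sub_one_le {ξ h₀ : ℝ} (hξ : 0 ≤ ξ) (H : PBond P i → 𝔸) (hH : ∀ b, ‖H b‖ ≤ h₀) (p : Plaq P i) :
    ‖((plaq (fun b => expI ξ (H b)) p : 𝔸ˣ) : 𝔸) - 1‖ ≤
      ξ * ‖H ⟨p.src, p.μ⟩ + H ⟨p.src.shift p.μ, p.ν⟩ - H ⟨p.src.shift p.ν, p.μ⟩ - H ⟨p.src, p.ν⟩‖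
        + 1 / 2 * (4 * h₀) ^ 2 * ξ ^ 2 * Real.exp (ξ * (4 * h₀)) := by
  have e := norm_plaqU_prodCfg_sub_one_le (torusT P i) (dirForm (1 : PBond P i → 𝔸ˣ)) hξ (dirForm H) p.μ p.ν p.src
  have hplaq : plaq (fun b => expI ξ (H b)) p =
      plaqU (torusT P i) (prodCfg (dirForm (1 : PBond P i → 𝔸ˣ)) ξ (dirForm H)) p.μ p.ν p.src := by
    rw [← sub310_one_eq, plaq_eq_plaqU, dirForm_sub310]
  have hone : ‖((plaqU (torusT P i) (dirForm (1 : PBond P i → 𝔸ˣ)) p.μ p.ν p.src : 𝔸ˣ) : 𝔸) - 1‖ = 0 := by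
    simp [plaqU, dirForm]
  have hcurl : curl (torusT P i) (dirForm (1 : PBond P i → 𝔸ˣ)) (dirForm H) p.μ p.ν p.src =
      H ⟨p.src, p.μ⟩ + H ⟨p.src.shift p.μ, p.ν⟩ - H ⟨p.src.shift p.ν, p.μ⟩ - H ⟨p.src, p.ν⟩ := by
    simp only [curl, covD, dirForm_apply, Pi.one_apply, R_one, torusT_apply]
    abel
  have hS0 := letterSize_nonneg (torusT P i) (dirForm (1 : PBond P i → 𝔸ˣ)) (dirForm H) p.μ p.ν p.src
  have hS : letterSize (torusT P i) (dirForm (1 : PBond P i → 𝔸ˣ)) (dirForm H) p.μ p.ν p.src ≤ 4 * h₀ := by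
    simp only [letterSize, dirForm_apply, Pi.one_apply, R_one, torusT_apply]
    linarith [hH ⟨p.src, p.μ⟩, hH ⟨p.src.shift p.μ, p.ν⟩, hH ⟨p.src.shift p.ν, p.μ⟩, hH ⟨p.src, p.ν⟩]
  rw [hone, mul_zero, add_zero, hcurl] at e
  rw [hplaq]
  refine e.trans (add_le_add le_rfl ?_)
  have h1 : letterSize (torusT P i) (dirForm (1 : PBond P i → 𝔸ˣ)) (dirForm H) p.μ p.ν p.src ^ 2 ≤ (4 * h₀) ^ 2 :=
    pow_le_pow_left₀ hS0 hS 2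
  have h2 : Real.exp (ξ * letterSize (torusT P i) (dirForm (1 : PBond P i → 𝔸ˣ)) (dirForm H) p.μ p.ν p.src) ≤ Real.exp (ξ * (4 * h₀)) :=
    Real.exp_le_exp.mpr (mul_le_mul_of_nonneg_left hS hξ)
  exact mul_le_mul (mul_le_mul_of_nonneg_right (mul_le_mul_of_nonneg_left h1 (by norm_num)) (sq_nonneg ξ)) h2
    (Real.exp_pos _).le (by positivity)

omit [NormedAlgebra ℂ 𝔸] [CompleteSpace 𝔸] in
/-- **Gauge conjugation of a plaquette deviation**: `∂B(p) = w(x)·∂(B^{w⁻¹})(p)·w(x)⁻¹` (`plaq_gaugeU`), so `‖∂B(p) − 1‖ ≤ ‖w(x)‖·‖∂(B^{w⁻¹})(p) − 1‖·‖w(x)⁻¹‖`.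
[cite: Balaban1987RG1, (1.10)–(1.11) p.262 (bookkeeping)] -/
theorem norm_plaq_sub_one_le_conj (w : Site P i → 𝔸ˣ) (B : PBond P i → 𝔸ˣ) (p : Plaq P i) :
    ‖((plaq B p : 𝔸ˣ) : 𝔸) - 1‖ ≤
      ‖((w p.src : 𝔸ˣ) : 𝔸)‖ * ‖((plaq (gaugeU w⁻¹ B) p : 𝔸ˣ) : 𝔸) - 1‖ * ‖(((w p.src)⁻¹ : 𝔸ˣ) : 𝔸)‖ := by
  have key : plaq B p = w p.src * plaq (gaugeU w⁻¹ B) p * (w p.src)⁻¹ := by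
    rw [plaq_gaugeU, Pi.inv_apply, inv_inv]; group
  have hval : ((plaq B p : 𝔸ˣ) : 𝔸) - 1 =
      ((w p.src : 𝔸ˣ) : 𝔸) * (((plaq (gaugeU w⁻¹ B) p : 𝔸ˣ) : 𝔸) - 1) * (((w p.src)⁻¹ : 𝔸ˣ) : 𝔸) := by
    rw [mul_sub, sub_mul, mul_one, Units.mul_inv, ← Units.val_mul, ← Units.val_mul, ← key]
  rw [hval]
  exact (norm_mul_le _ _).trans (mul_le_mul_of_nonneg_right (norm_mul_le _ _) (norm_nonneg _))

omit [NormedAlgebra ℂ 𝔸] [CompleteSpace 𝔸] in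
/-- Submultiplicativity for four factors. [folklore] -/
private theorem norm_mul4_le (x y z t : 𝔸) : ‖x * y * z * t‖ ≤ ‖x‖ * ‖y‖ * ‖z‖ * ‖t‖ := by
  calc ‖x * y * z * t‖ ≤ ‖x * y * z‖ * ‖t‖ := norm_mul_le _ _
    _ ≤ ‖x * y‖ * ‖z‖ * ‖t‖ := by gcongr; exact norm_mul_le _ _
    _ ≤ ‖x‖ * ‖y‖ * ‖z‖ * ‖t‖ := by gcongr; exact norm_mul_le _ _

omit [NormedAlgebra ℂ 𝔸] [CompleteSpace 𝔸] in
/-- **The costs of four gauge transformations multiply**: if `‖a‖‖a⁻¹‖ ≤ e^{e₁}`, …, `‖d‖‖d⁻¹‖ ≤ e^{e₄}` then `‖abcd‖‖(abcd)⁻¹‖ ≤ e^{e₁+e₂+e₃+e₄}` (the composite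
`v ū₁ v_j u_j` of (3.39), costs (3.26) ∕ (3.27) ∕ (3.37)). [cite: Balaban1987RG1, (3.26)–(3.27) p.275, (3.37) p.277 (bookkeeping)] -/
theorem norm_mul_norm_inv_prod4_le {a b c d : 𝔸ˣ} {e₁ e₂ e₃ e₄ : ℝ}
    (ha : ‖(a : 𝔸)‖ * ‖((a⁻¹ : 𝔸ˣ) : 𝔸)‖ ≤ Real.exp e₁) (hb : ‖(b : 𝔸)‖ * ‖((b⁻¹ : 𝔸ˣ) : 𝔸)‖ ≤ Real.exp e₂)
    (hc : ‖(c : 𝔸)‖ * ‖((c⁻¹ : 𝔸ˣ) : 𝔸)‖ ≤ Real.exp e₃) (hd : ‖(d : 𝔸)‖ * ‖((d⁻¹ : 𝔸ˣ) : 𝔸)‖ ≤ Real.exp e₄) :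
    ‖((a * b * c * d : 𝔸ˣ) : 𝔸)‖ * ‖(((a * b * c * d)⁻¹ : 𝔸ˣ) : 𝔸)‖ ≤ Real.exp (e₁ + e₂ + e₃ + e₄) := by
  have h1 : ‖((a * b * c * d : 𝔸ˣ) : 𝔸)‖ ≤ ‖(a : 𝔸)‖ * ‖(b : 𝔸)‖ * ‖(c : 𝔸)‖ * ‖(d : 𝔸)‖ := by
    simp only [Units.val_mul]
    exact norm_mul4_le _ _ _ _
  have h2 : ‖(((a * b * c * d)⁻¹ : 𝔸ˣ) : 𝔸)‖ ≤
      ‖((d⁻¹ : 𝔸ˣ) : 𝔸)‖ * ‖((c⁻¹ : 𝔸ˣ) : 𝔸)‖ * ‖((b⁻¹ : 𝔸ˣ) : 𝔸)‖ * ‖((a⁻¹ : 𝔸ˣ) : 𝔸)‖ := by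
    rw [show (a * b * c * d)⁻¹ = d⁻¹ * c⁻¹ * b⁻¹ * a⁻¹ by simp only [mul_inv_rev, mul_assoc]]
    simp only [Units.val_mul]
    exact norm_mul4_le _ _ _ _
  calc ‖((a * b * c * d : 𝔸ˣ) : 𝔸)‖ * ‖(((a * b * c * d)⁻¹ : 𝔸ˣ) : 𝔸)‖
      ≤ (‖(a : 𝔸)‖ * ‖(b : 𝔸)‖ * ‖(c : 𝔸)‖ * ‖(d : 𝔸)‖) *
          (‖((d⁻¹ : 𝔸ˣ) : 𝔸)‖ * ‖((c⁻¹ : 𝔸ˣ) : 𝔸)‖ * ‖((b⁻¹ : 𝔸ˣ) : 𝔸)‖ * ‖((a⁻¹ : 𝔸ˣ) : 𝔸)‖) :=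
        mul_le_mul h1 h2 (norm_nonneg _) (by positivity)
    _ = (‖(a : 𝔸)‖ * ‖((a⁻¹ : 𝔸ˣ) : 𝔸)‖) * (‖(b : 𝔸)‖ * ‖((b⁻¹ : 𝔸ˣ) : 𝔸)‖) * (‖(c : 𝔸)‖ * ‖((c⁻¹ : 𝔸ˣ) : 𝔸)‖) *
          (‖(d : 𝔸)‖ * ‖((d⁻¹ : 𝔸ˣ) : 𝔸)‖) := by ring
    _ ≤ Real.exp e₁ * Real.exp e₂ * Real.exp e₃ * Real.exp e₄ := by gcongr
    _ = Real.exp (e₁ + e₂ + e₃ + e₄) := by rw [Real.exp_add, Real.exp_add, Real.exp_add]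

end Elementary

/-! ## §2. The core: a by-reference package `JInputs` at `τ = 1` with the ZERO letter `𝐊 = 0` makes its datum's `(k+1)`-background second-order flat on `X` -/

section Core

variable {P : Params} {i : ℕ} {𝔸 : Type} [NormedRing 𝔸] [NormedAlgebra ℂ 𝔸] [CompleteSpace 𝔸]

/-- **★ THE CORE (any value model, any frames)**: let `J : JInputs 𝓜 c F F′ cs cs′ Y π η B₃″ γ₀′ j τ n 𝐊 𝐀` be p07's by-reference package at ONE value of the variables with
`τ = 1` and the ZERO letter `𝐊 = 0`, `0 < ξ`.  Then its upper-space datum `Φ₀` has a SECOND-ORDER FLAT `(k+1)`-background on `X`: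
`‖∂(F′.bg.Un cs′.j Φ₀.U)(p) − 1‖ ≤ e^{c_w}·(ξ²·2B₃y² + ½(4x′)²ξ²e^{ξ·4x′})` for every `p ∈ F.X.plaqs`, where `x′ = B₃²O(1)Mα₀L^{j−1}η` ((3.37)), `y = B₃O(1)Mα₀L^{j−1}η`,
`c_w = O(1)Mα₁ + 2B₃O(1)Mα₀ + B₃²O(1)Mα₀` (the four costs).  Route: `h45τ` at `𝐊 = 0`, `τ = 1` ⇒ `|ℓ| < B₃y²`; `h45` ⇒ `|∂𝐇| ≤ 2ξB₃y²`; `hH`; §1 at `exp iξ𝐇`;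
`h339` + `norm_plaq_sub_one_le_conj` + the costs.  `𝐀` plays no rôle. [cite: Balaban1987RG1, (3.37) p.277, (3.39)–(3.40) p.278, (3.43) p.278, (3.45) p.279] -/
theorem norm_plaq_bg_sub_one_le_of_jInputs {𝓜 : Model 𝔸} {c : B12Sec2to5.Lemma4Consts} {F F' : Frame P i 𝔸} {cs cs' : StepConsts}
    {Y : Region P i} {π : 𝔸 →ₗ[ℂ] 𝔸} {η B₃'' γ₀' : ℝ} {j : ℕ} {τ n : ℝ} {K A : PBond P i → 𝔸}
    (hξ : 0 < cs.ξ) (J : JInputs 𝓜 c F F' cs cs' Y π η B₃'' γ₀' j τ n K A) (hτ : τ = 1) (hK : ∀ b, K b = 0)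
    (p : Plaq P i) (hp : p ∈ F.X.plaqs) :
    ‖((plaq (F'.bg.Un cs'.j J.Φ₀.U) p : 𝔸ˣ) : 𝔸) - 1‖ ≤
      Real.exp (c.O₁ * c.M * c.α₁ + c.B₃ * c.O₁ * c.M * c.α₀ + c.B₃ * c.O₁ * c.M * c.α₀ + c.B₃ ^ 2 * c.O₁ * c.M * c.α₀) *
        (cs.ξ ^ 2 * (2 * (c.B₃ * (c.B₃ * c.O₁ * c.M * c.α₀ * (c.L ^ (j - 1) * η)) ^ 2))
          + 1 / 2 * (4 * (c.B₃ ^ 2 * c.O₁ * c.M * c.α₀ * (c.L ^ (j - 1) * η))) ^ 2 * cs.ξ ^ 2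
              * Real.exp (cs.ξ * (4 * (c.B₃ ^ 2 * c.O₁ * c.M * c.α₀ * (c.L ^ (j - 1) * η))))) := by
  subst hτ
  -- (3.45)τ at `𝐊 = 0`, `τ = 1`: `|ℓ(p)| < B₃y²`
  have hℓ : ‖J.ℓ p‖ < c.B₃ * (c.B₃ * c.O₁ * c.M * c.α₀ * (c.L ^ (j - 1) * η)) ^ 2 := by
    have h := J.h45τ p hp
    simp only [hK, add_zero, sub_zero, smul_zero, Complex.ofReal_one, one_smul, zero_sub, norm_neg] at h
    exact h
  -- (3.45) at `p`, (3.37), (3.39)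
  have h45 := J.h45 p hp
  have h339 := J.h339 p hp
  set x' : ℝ := c.B₃ ^ 2 * c.O₁ * c.M * c.α₀ * (c.L ^ (j - 1) * η) with hx'
  set q : ℝ := c.B₃ * (c.B₃ * c.O₁ * c.M * c.α₀ * (c.L ^ (j - 1) * η)) ^ 2 with hq
  set dH : 𝔸 := J.H ⟨p.src, p.μ⟩ + J.H ⟨p.src.shift p.μ, p.ν⟩ - J.H ⟨p.src.shift p.ν, p.μ⟩ - J.H ⟨p.src, p.ν⟩ with hdH
  -- `|∂𝐇(p)| ≤ ξ·2B₃y²`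
  have hdHle : ‖dH‖ ≤ cs.ξ * (2 * q) := by
    have h1 : ‖(cs.ξ : ℂ)⁻¹ • dH‖ ≤ 2 * q := by
      calc ‖(cs.ξ : ℂ)⁻¹ • dH‖ = ‖((cs.ξ : ℂ)⁻¹ • dH - J.ℓ p) + J.ℓ p‖ := by rw [sub_add_cancel]
        _ ≤ ‖(cs.ξ : ℂ)⁻¹ • dH - J.ℓ p‖ + ‖J.ℓ p‖ := norm_add_le _ _
        _ ≤ 2 * q := by linarith [h45, hℓ]
    exact (norm_eta_inv_smul_le_iff hξ _).mp h1
  -- §1 at `exp iξ𝐇`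
  have hE : ‖((plaq (fun b => expI cs.ξ (J.H b)) p : 𝔸ˣ) : 𝔸) - 1‖ ≤
      cs.ξ * ‖dH‖ + 1 / 2 * (4 * x') ^ 2 * cs.ξ ^ 2 * Real.exp (cs.ξ * (4 * x')) :=
    norm_plaq_expI_sub_one_le hξ.le J.H (fun b => (J.hH b).le) p
  -- undo the gauge of (3.39)
  have hconj := norm_plaq_sub_one_le_conj (J.v * J.ubar1 * J.vj * J.uj) (F'.bg.Un cs'.j J.Φ₀.U) p
  rw [← h339] at hconj
  have hw : ‖(((J.v * J.ubar1 * J.vj * J.uj) p.src : 𝔸ˣ) : 𝔸)‖ * ‖((((J.v * J.ubar1 * J.vj * J.uj) p.src)⁻¹ : 𝔸ˣ) : 𝔸)‖ ≤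
      Real.exp (c.O₁ * c.M * c.α₁ + c.B₃ * c.O₁ * c.M * c.α₀ + c.B₃ * c.O₁ * c.M * c.α₀ + c.B₃ ^ 2 * c.O₁ * c.M * c.α₀) := by
    simp only [Pi.mul_apply]
    exact norm_mul_norm_inv_prod4_le (J.hv p.src) (J.hubar1 p.src) (J.hvj p.src) (J.huj p.src)
  have hfirst : cs.ξ * ‖dH‖ ≤ cs.ξ ^ 2 * (2 * q) := by
    calc cs.ξ * ‖dH‖ ≤ cs.ξ * (cs.ξ * (2 * q)) := mul_le_mul_of_nonneg_left hdHle hξ.le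
      _ = cs.ξ ^ 2 * (2 * q) := by ring
  calc ‖((plaq (F'.bg.Un cs'.j J.Φ₀.U) p : 𝔸ˣ) : 𝔸) - 1‖
      ≤ ‖(((J.v * J.ubar1 * J.vj * J.uj) p.src : 𝔸ˣ) : 𝔸)‖ * ‖((plaq (fun b => expI cs.ξ (J.H b)) p : 𝔸ˣ) : 𝔸) - 1‖ *
          ‖((((J.v * J.ubar1 * J.vj * J.uj) p.src)⁻¹ : 𝔸ˣ) : 𝔸)‖ := hconj
    _ = ‖(((J.v * J.ubar1 * J.vj * J.uj) p.src : 𝔸ˣ) : 𝔸)‖ * ‖((((J.v * J.ubar1 * J.vj * J.uj) p.src)⁻¹ : 𝔸ˣ) : 𝔸)‖ *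
          ‖((plaq (fun b => expI cs.ξ (J.H b)) p : 𝔸ˣ) : 𝔸) - 1‖ := by ring
    _ ≤ Real.exp (c.O₁ * c.M * c.α₁ + c.B₃ * c.O₁ * c.M * c.α₀ + c.B₃ * c.O₁ * c.M * c.α₀ + c.B₃ ^ 2 * c.O₁ * c.M * c.α₀) *
          (cs.ξ * ‖dH‖ + 1 / 2 * (4 * x') ^ 2 * cs.ξ ^ 2 * Real.exp (cs.ξ * (4 * x'))) :=
        mul_le_mul hw hE (norm_nonneg _) (Real.exp_pos _).le
    _ ≤ Real.exp (c.O₁ * c.M * c.α₁ + c.B₃ * c.O₁ * c.M * c.α₀ + c.B₃ * c.O₁ * c.M * c.α₀ + c.B₃ ^ 2 * c.O₁ * c.M * c.α₀) *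
          (cs.ξ ^ 2 * (2 * q) + 1 / 2 * (4 * x') ^ 2 * cs.ξ ^ 2 * Real.exp (cs.ξ * (4 * x'))) :=
        mul_le_mul_of_nonneg_left (add_le_add hfirst le_rfl) (Real.exp_pos _).le

end Core

/-! ## §3. At NODE 00's objects: every zero-letter `B12Package Rz cB λ` returns `δ₀(λ)`-flat data -/

section Package

variable {P : Params} {N M : ℕ} {Rz : Sect2.Residual P (MatA N)} {cB : ℝ}

/-- **★★ EVERY ZERO-LETTER PACKAGE HAS `δ₀`-FLAT DATA**: for a residual [B12] layer with `λ.K = 0` (the letter `𝐀₂` is irrelevant), `0 ∈ (3.31)` and `0 < α₃`, and ANY by-reference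
package `pkg : B12Package Rz cB λ`, the upper-space datum `Φ₀` that `pkg.inputs` returns at an admissible input `Φ` (with `𝐀 = 0`, `τ = 1`, `B′ = 0`) has a `(k+1)`-background
(`(λ.frameBox Rz).bg.Un (k+1)`, i.e. the PINNED `Rz.bgI` at `□̃⁵`) whose every `X`-plaquette is within `δ₀(λ)` of `1` — §2 at NODE 00's frames ∕ constants (`ξ = L⁻ʲ > 0`).
[cite: Balaban1987RG1, (3.37)–(3.45) pp.277–279, Lemma 4 p.280 (bookkeeping: the junk letter against the package's own identities)] -/
theorem norm_plaq_bg_repr_sub_one_le_of_zero_letters (lam : ResidB12Run P N M) (hK : ∀ Φ A τ, lam.K Φ A τ = 0) (pkg : B12Package Rz cB lam)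
    (h0 : (0 : PBond P 0 → MatA N) ∈ lam.A331) (hα₃ : 0 < lam.consts.α₃) {Φ : FieldPair P 0 (MatA N)ˣ (MatA N)}
    (hΦ : Φ ∈ space (suModel N) (lam.frameBox Rz) (lam.csBox cB) ((1 + 2 * lam.consts.β) * lam.consts.α₀) ((1 + 2 * lam.consts.β) * lam.consts.α₁) lam.α₀)
    (p : Plaq P 0) (hp : p ∈ (lam.frameX Rz).X.plaqs) :
    ‖((plaq ((lam.frameBox Rz).bg.Un (lam.csBox cB).j
        (pkg.inputs Φ 0 1 0 hΦ h0 zero_le_one le_rfl (by rw [norm_zero]; exact hα₃)).Φ₀.U) p : (MatA N)ˣ) : MatA N) - 1‖ ≤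
      Real.exp (lam.consts.O₁ * lam.consts.M * lam.consts.α₁ + lam.consts.B₃ * lam.consts.O₁ * lam.consts.M * lam.consts.α₀
          + lam.consts.B₃ * lam.consts.O₁ * lam.consts.M * lam.consts.α₀ + lam.consts.B₃ ^ 2 * lam.consts.O₁ * lam.consts.M * lam.consts.α₀) *
        ((lam.csX cB).ξ ^ 2 * (2 * (lam.consts.B₃ * (lam.consts.B₃ * lam.consts.O₁ * lam.consts.M * lam.consts.α₀ * (lam.consts.L ^ (lam.idx.j - 1) * lam.idx.η)) ^ 2))
          + 1 / 2 * (4 * (lam.consts.B₃ ^ 2 * lam.consts.O₁ * lam.consts.M * lam.consts.α₀ * (lam.consts.L ^ (lam.idx.j - 1) * lam.idx.η))) ^ 2 * (lam.csX cB).ξ ^ 2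
              * Real.exp ((lam.csX cB).ξ * (4 * (lam.consts.B₃ ^ 2 * lam.consts.O₁ * lam.consts.M * lam.consts.α₀ * (lam.consts.L ^ (lam.idx.j - 1) * lam.idx.η))))) :=
  -- `0 < ξ = L⁻ʲ` (n09-w4's `N09B12PackageAtRzOfRecordLocated.csX_ξ_pos`, one term; not re-declared)
  norm_plaq_bg_sub_one_le_of_jInputs (pow_pos (inv_pos.mpr (Nat.cast_pos.mpr P.L_pos)) _) _ rfl (fun b => by rw [hK]; rfl) p hp

end Package

end Summit.QuantumFields.YangMills.BalabanUVNodes.N09B12ZeroLetterFlatness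

end
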